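import Mathlib
import Summits.QuantumFields.BalabanUV.Beta.AnalyticWalkSum216Neumann

/-!
# [Balaban1988RG2Cluster] p. 13 «the operator C(xI + C*Δ_kC)⁻¹C* is representated by the integral (3.185) [13] with the
# additional term −½x‖χ*(QA + D̄μ(QA))‖² … G̃₂ replaced by G̃₃(x)»: the WOODBURY RECOMBINATION of route A.3′ as ONE walk-term
# family with x-UNIFORM (2.16)-type data — rider (ρ3) of the row-D4 owner's `OUTLINE-D4-NODE-A.md` §3b, END in the currency
# the (T1) reduction consumes (cell topic `Summits/QuantumFields/BalabanUV/Beta`; census `BETA/REMAINDER-BETA.md` §10)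

HONEST FRAMING (cell rule).  Discharging `BetaPertH` makes Bałaban's UV stability UNCONDITIONAL — a real
constructive-QFT result; NOT the continuum limit, NOT the Clay problem.  This module discharges NOTHING of `BetaPertH`.
It closes, in [folklore] abstract form, rider (ρ3) on which the owner promoted route A.3′ to the primary route for
terminal leaf (T2) G-IF-10 (journal l.8635; OUTLINE §3b): *«the recombination `G₂ − G₂Q̂*·x(I + xK)⁻¹·Q̂G₂` (and its
Q̃-projected version) as ONE walk expansion … = A.4.6-type composition bookkeeping (walk ∘ walk)»*.  Route A.3′ reads
(T2) ⇐ (T3) + Woodbury + A2 + A3: the x-vertex `x·Q̂*Q̂` (`Q̂ := χ(I + D̄μ)Q`, `x ∈ [0, 2γ₁]` — B10 (63), [II] (2.7))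
is moved to the UNIT lattice by the Woodbury identity, inverted there by d4-p3's walk inversion
(`UnitLatticeWalkInversion`, `UnitLatticeLocalInverse`, `UnitLatticeWalkInversionDecay` — A3), and recombined.  THIS
FILE: (§1) the Woodbury identity in the needed shape `(G⁻¹ + P(c·1)Q)⁻¹ = G − c·G·[P(1 + cQGP)⁻¹Q]·G` (Mathlib
`Matrix.add_mul_mul_inv_eq_sub`); (§2) the RECOMBINED FAMILY `recombTerm TG TL c` on `W ⊕ (W × (V × W))` built from a
family `TG` for `G` (= (T3)'s output, hypothesis) and a family `TL` for the lifted unit-lattice inverse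
`L = P(1 + cQGP)⁻¹Q` (= A3's output + its U-localisation refinement, hypothesis), with term data whose majorant and
constants depend on `c` ONLY THROUGH A BOUND `‖c‖ ≤ X` (`AnalyticWalkSum216Algebra`'s `sum`∕`smul`∕`prod`) —
x-UNIFORMITY on the compact range; (§3) the ENDs: `termSum (recombTerm TG TL c) σ = G σ − c·G σ·L σ·G σ`
(`termSum_recomb`), the (2.16)-shape bounds `wrs_recomb`∕`wrs_recomb_sub` with constant `ρ_G + X·ρ_G²ρ_L` BY NAME
(`TermData.wrs_termSum(_sub)` → an4's `wrs_termSum_sub_of_termwise`), and `woodbury_termSum`: the recombined sum IS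
`(G σ⁻¹ + P(c·1)Q)⁻¹ = G₃`.  Records-level: NO class change on (T2)∕(T3) — the two input families are the located open
inputs (NODE O.2 + (T3); A3's refinement); riders (ρ1) (the Q̃-projection inverse `(Q̃G₃Q̃*)⁻¹` at `x`: LOCATED in the
tree — r1-g4 `B9SectEKernel.form_le_of_right_inverse`∕`coercive_add_smul_one`∕`resolvent_decay_uniform` + d4-p3's
`AccretiveCombesThomasSandwich`) and (ρ2) (x-uniform smallness of A3's remainder: d4-p3's `wrs_Rem`, «M sufficiently
large») are NOT this file's.  NOT summit progress.  Unit `b2b-balaban-beta-an4-g37` (owner of `BINDER-OWNERS.md` row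
D4); cell `GAPS.md` C-an4-87.

CITATION HEADER (lean-in-tree rule).  [II] = T. Bałaban, *Renormalization group approach to lattice gauge field theories.
II. Cluster expansions*, Commun. Math. Phys. **116**, 1–22 (1988) [Balaban1988RG2Cluster], p. 13 [PDF 13] (render
`HOME/b2b-balaban-ref1/pages/1988-cmp116-rg-II-cluster/…-p013-x2.png`, READ AS IMAGE by this lineage gens 32–36),
verbatim: *"The resolvent (xI + C*Δ_kC)⁻¹ has a representation similar to (C*Δ_kC)⁻¹. More exactly, the operator
C(xI + C*Δ_kC)⁻¹C* is representated by the integral (3.185) [13] with the additional term −½x‖χ*(QA + D̄μ(QA))‖² under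
the exponential function … This term determines a nonnegative, bounded and almost local operator. The integral yields the
representation (3.185) [13], with the operator G̃₂ replaced by G̃₃(x), which is defined as G̃₂, but with this additional
operator. The operator G̃₃(x) has the same properties as G̃₂, especially it can be expanded into a generalized random walk
expansion."*; B10 = T. Bałaban, *Ultraviolet stability of three-dimensional lattice pure gauge field theories*, Commun.
Math. Phys. **102**, 255–275 (1985) [Balaban1985UV3], (63) p. 272: the x-range `[0, 2γ₁]` (cell C-adv4-61 UPDATE: COMPACT,
«bounded-not-small x-vertex»).  Nothing printed is asserted: the sentences LOCATE the object `G₃(x) = (G₂⁻¹ + xQ̂*Q̂)⁻¹`;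
the Woodbury route to it is the cell's [analysis] (OUTLINE A.3′), not print's.

WHAT IS CERTIFIED HERE (kernel, sorry-free; [folklore]).  §1 `inv_smul_one_add`, `isUnit_smul_one`, **`woodbury`**;
§2 `recombTerm`∕`recombMaj`∕`recombConst`, **`termData_recomb`** (`‖c‖ ≤ X` ⟹ term data with `X`, not `c`),
`tsum_recombConst_le` (`≤ ρ + X·ρ·(ρ′·ρ)`); §3 **`termSum_recomb`**, **`wrs_recomb`**, **`wrs_recomb_sub`**,
**`woodbury_termSum`**; §4 `blockLocal_mul`∕`_add`∕`_smul`∕`_one`∕**`blockLocal_recomb`** — an4's locality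
interface `DecouplingSupport110.BlockLocal` (same cube family) is preserved by the recombination; §5 non-vacuity.
NOT CLAIMED.  Any expansion of Bałaban's `G₂`, `Q̂`, `(1 + xK)⁻¹` (hypothesis families `TG`, `TL`); the U-localisation of
the recombined terms; riders (ρ1)∕(ρ2); (T2)∕(T3) themselves.  NO class change on any GAPS row; NOT summit progress.
PRIOR ART IN THE TREE (searched 2026-08-20; nothing re-derived): Mathlib `Matrix.add_mul_mul_inv_eq_sub` (Woodbury, used
BY NAME); `PropagatorWoodburyFibre(Reduction)` (gan24-p3: Woodbury for the soft constraint on ONE Bloch fibre at `U = 1`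
— a different object and currency); `B9SectECov` (r1: constrained Woodbury at form level, real); `B10Eq63Rep` (b10-g16:
the x-integral bookkeeping GIVEN representation∕continuity∕bounds — the consumer downstream of (T2));
`AccretiveCombesThomasSandwich`∕`UnitLatticeWalkInversion*` (d4-p3: A2∕A3, the unit-lattice side).
-/

namespace Summit.QuantumFields.BalabanUV.Beta.AnalyticWalkSum216Recomb

open Metric Set
open Literature.MathematicalPhysics.QuantumFieldTheory.Balaban1983to89
open B13PerturbativeStep (WRS WeightHyp)
open Summit.QuantumFields.BalabanUV.Beta.AnalyticWalkSum216 (termSum)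
open Summit.QuantumFields.BalabanUV.Beta.AnalyticWalkSum216Algebra (TermData prodTerm prodMaj prodConst
  termSum_prod termSum_sum termSum_smul tsum_sum_elim tsum_prodConst_le)

noncomputable section

variable {n : Type*} [Fintype n] {W V : Type*} {κ : ℝ} {d : n → n → ℝ} {R : ℝ}

/-! ## §1 The Woodbury identity in the shape route A.3′ uses -/

section Woodbury

variable [DecidableEq n] {Y : Type*} [Fintype Y] [DecidableEq Y]

/-- `c • 1` is invertible for `c ≠ 0` (determinant `c^{|Y|}`). [folklore] -/
theorem isUnit_smul_one {c : ℂ} (hc : c ≠ 0) : IsUnit (c • (1 : Matrix Y Y ℂ)) :=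
  (Matrix.isUnit_iff_isUnit_det _).2 (by
    rw [Matrix.det_smul, Matrix.det_one, mul_one]
    exact (pow_ne_zero _ hc).isUnit)

/-- `(c • 1)⁻¹ = c⁻¹ • 1` for `c ≠ 0`. [folklore] -/
theorem inv_smul_one {c : ℂ} (hc : c ≠ 0) : (c • (1 : Matrix Y Y ℂ))⁻¹ = c⁻¹ • (1 : Matrix Y Y ℂ) :=
  Matrix.inv_eq_left_inv (by rw [Matrix.smul_mul, Matrix.one_mul, smul_smul, inv_mul_cancel₀ hc, one_smul])

/-- The unit-lattice pivot: `((c • 1)⁻¹ + K)⁻¹ = c • (1 + c • K)⁻¹` when `1 + c • K` is invertible, `c ≠ 0` — the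
factor `x(1 + xK)⁻¹` of route A.3′. [folklore] -/
theorem inv_smul_one_add (K : Matrix Y Y ℂ) {c : ℂ} (hc : c ≠ 0) (hK : IsUnit (1 + c • K)) :
    ((c • (1 : Matrix Y Y ℂ))⁻¹ + K)⁻¹ = c • (1 + c • K)⁻¹ := by
  have h2 : (c • (1 : Matrix Y Y ℂ))⁻¹ + K = c⁻¹ • (1 + c • K) := by
    rw [inv_smul_one hc, smul_add, smul_smul, inv_mul_cancel₀ hc, one_smul]
  rw [h2]
  refine Matrix.inv_eq_left_inv ?_
  rw [Matrix.smul_mul, Matrix.mul_smul, smul_smul, mul_inv_cancel₀ hc, one_smul,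
    Matrix.nonsing_inv_mul _ ((Matrix.isUnit_iff_isUnit_det _).mp hK)]

/-- `c⁻¹ • (1 + c • K)` is invertible when `1 + c • K` is and `c ≠ 0`. [folklore] -/
theorem isUnit_inv_smul_one_add (K : Matrix Y Y ℂ) {c : ℂ} (hc : c ≠ 0) (hK : IsUnit (1 + c • K)) :
    IsUnit ((c • (1 : Matrix Y Y ℂ))⁻¹ + K) := by
  have h2 : (c • (1 : Matrix Y Y ℂ))⁻¹ + K = c⁻¹ • (1 + c • K) := by
    rw [inv_smul_one hc, smul_add, smul_smul, inv_mul_cancel₀ hc, one_smul]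
  rw [h2, Matrix.isUnit_iff_isUnit_det, Matrix.det_smul]
  exact ((pow_ne_zero _ (inv_ne_zero hc)).isUnit).mul ((Matrix.isUnit_iff_isUnit_det _).mp hK)

/-- **WOODBURY, route-A.3′ shape**: for invertible `G` (fine lattice), `P : n × Y`, `Q : Y × n` (the sandwich by the
dressed block averaging and its adjoint), `c ≠ 0` (the x-vertex strength) and invertible `1 + c·QGP` (the unit-lattice
operator A3 inverts): `(G⁻¹ + P(c·1)Q)⁻¹ = G − c·G·(P(1 + c·QGP)⁻¹Q)·G` (Mathlib `Matrix.add_mul_mul_inv_eq_sub` BY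
NAME). [folklore] -/
theorem woodbury (G : Matrix n n ℂ) (P : Matrix n Y ℂ) (Q : Matrix Y n ℂ) {c : ℂ} (hc : c ≠ 0) (hG : IsUnit G)
    (hK : IsUnit (1 + c • (Q * G * P))) :
    (G⁻¹ + P * (c • (1 : Matrix Y Y ℂ)) * Q)⁻¹ = G - c • (G * (P * (1 + c • (Q * G * P))⁻¹ * Q) * G) := by
  have hGdet : IsUnit G.det := (Matrix.isUnit_iff_isUnit_det _).mp hG
  have hGG : G⁻¹⁻¹ = G := Matrix.nonsing_inv_nonsing_inv G hGdet
  have hGi : IsUnit G⁻¹ := by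
    rw [Matrix.isUnit_iff_isUnit_det, Matrix.isUnit_nonsing_inv_det_iff]
    exact hGdet
  have hAC : IsUnit ((c • (1 : Matrix Y Y ℂ))⁻¹ + Q * G⁻¹⁻¹ * P) := by
    rw [hGG]
    exact isUnit_inv_smul_one_add (Q * G * P) hc hK
  rw [Matrix.add_mul_mul_inv_eq_sub G⁻¹ P _ Q hGi (isUnit_smul_one hc) hAC, hGG,
    inv_smul_one_add (Q * G * P) hc hK]
  simp only [Matrix.mul_smul, Matrix.smul_mul, Matrix.mul_assoc]

end Woodbury

/-! ## §2 The recombined family and its x-uniform term data -/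

section Recomb

/-- The index type of the recombined family: a term of `G`, or a triple (term of `G`, term of `L`, term of `G`). [folklore] -/
abbrev RIdx (W V : Type*) := W ⊕ (W × (V × W))

/-- The RECOMBINED FAMILY `G − c·G·L·G` as ONE walk-term family: `Sum.elim TG (−c • TG·(TL·TG))` ([II] p. 13: «G̃₃(x)
… can be expanded into a generalized random walk expansion»; the Woodbury route is the cell's).
[cite: Balaban1988RG2Cluster, p.13 after (2.7)] -/
def recombTerm (TG : W → ℂ → Matrix n n ℂ) (TL : V → ℂ → Matrix n n ℂ) (c : ℂ) :
    RIdx W V → ℂ → Matrix n n ℂ :=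
  Sum.elim TG (fun p σ => (-c) • prodTerm TG (prodTerm TL TG) p σ)

/-- Its majorant, with the x-vertex strength replaced by its bound `X`. [folklore] -/
def recombMaj (mG : W → n → n → ℝ) (mL : V → n → n → ℝ) (X : ℝ) : RIdx W V → n → n → ℝ :=
  Sum.elim mG (fun p i j => X * prodMaj mG (prodMaj mL mG) p i j)

/-- Its constants `ρ_w` resp. `X·ρ_w ρ′_v ρ_{w′}`. [folklore] -/
def recombConst (ρG : W → ℝ) (ρL : V → ℝ) (X : ℝ) : RIdx W V → ℝ :=
  Sum.elim ρG (fun p => X * prodConst ρG (prodConst ρL ρG) p)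

variable {TG : W → ℂ → Matrix n n ℂ} {mG : W → n → n → ℝ} {ρG : W → ℝ}
  {TL : V → ℂ → Matrix n n ℂ} {mL : V → n → n → ℝ} {ρL : V → ℝ}

/-- **x-UNIFORM TERM DATA OF THE RECOMBINED FAMILY**: from term data for `G` and for `L` and a bound `‖c‖ ≤ X` —
majorant and constants depend on `X`, NOT on `c` (so ONE set of data serves every `x ∈ [0, 2γ₁]`). [folklore] -/
theorem termData_recomb [Nonempty n] (hG : TermData κ d R TG mG ρG) (hL : TermData κ d R TL mL ρL)
    (hw : WeightHyp κ d) (hR : 0 < R) {c : ℂ} {X : ℝ} (hc : ‖c‖ ≤ X) :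
    TermData κ d R (recombTerm TG TL c) (recombMaj mG mL X) (recombConst ρG ρL X) :=
  hG.sum ((hG.prod (hL.prod hG hw hR) hw hR).smul (show ‖-c‖ ≤ X by rwa [norm_neg]))

/-- The constants of the recombined family sum to at most `ρ + X·ρ·(ρ′·ρ)`. [folklore] -/
theorem tsum_recombConst_le [Nonempty n] (hG : TermData κ d R TG mG ρG) (hL : TermData κ d R TL mL ρL)
    (hw : WeightHyp κ d) (hR : 0 < R) {X ρ ρ' : ℝ} (hX : 0 ≤ X) (hρG : ∑' w, ρG w ≤ ρ)
    (hρL : ∑' v, ρL v ≤ ρ') : ∑' x, recombConst ρG ρL X x ≤ ρ + X * (ρ * (ρ' * ρ)) := by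
  have hLG := hL.prod hG hw hR
  have h3 := hG.prod hLG hw hR
  have hX' : ‖(X : ℂ)‖ ≤ X := by rw [Complex.norm_real, Real.norm_of_nonneg hX]
  rw [recombConst, tsum_sum_elim hG (h3.smul hX'), tsum_mul_left]
  exact add_le_add hρG (mul_le_mul_of_nonneg_left
    (tsum_prodConst_le hG hLG hR hρG (tsum_prodConst_le hL hG hR hρL hρG)) hX)

/-! ## §3 ENDs -/

/-- **THE SUMMED RECOMBINED FAMILY IS `G − c·G·L·G`** on the disc. [folklore] -/
theorem termSum_recomb [Nonempty n] (hG : TermData κ d R TG mG ρG) (hL : TermData κ d R TL mL ρL)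
    (hw : WeightHyp κ d) (hR : 0 < R) (c : ℂ) {σ : ℂ} (hσ : σ ∈ ball (0 : ℂ) R) :
    termSum (recombTerm TG TL c) σ =
      termSum TG σ - c • (termSum TG σ * (termSum TL σ * termSum TG σ)) := by
  have hLG := hL.prod hG hw hR
  have h3 := (hG.prod hLG hw hR).smul (show ‖-c‖ ≤ ‖c‖ by rw [norm_neg])
  rw [recombTerm, termSum_sum hG h3 hw hR hσ, termSum_smul, termSum_prod hG hLG hw hR hσ,
    termSum_prod hL hG hw hR hσ, neg_smul, sub_eq_add_neg]

/-- **END (2.16)-shape AT EVERY POINT, x-UNIFORM**: `WRS κ d (termSum (recombTerm TG TL c) σ) (ρ + Xρ(ρ′ρ))` for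
`‖c‖ ≤ X`, `‖σ‖ < R`. [cite: Balaban1988RG2Cluster, (2.16) p.16] -/
theorem wrs_recomb [Nonempty n] (hG : TermData κ d R TG mG ρG) (hL : TermData κ d R TL mL ρL)
    (hw : WeightHyp κ d) (hR : 0 < R) {c : ℂ} {X ρ ρ' : ℝ} (hc : ‖c‖ ≤ X) (hρG : ∑' w, ρG w ≤ ρ)
    (hρL : ∑' v, ρL v ≤ ρ') {σ : ℂ} (hσ : σ ∈ ball (0 : ℂ) R) :
    WRS κ d (termSum (recombTerm TG TL c) σ) (ρ + X * (ρ * (ρ' * ρ))) :=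
  (termData_recomb hG hL hw hR hc).wrs_termSum hw hR
    (tsum_recombConst_le hG hL hw hR ((norm_nonneg c).trans hc) hρG hρL) hσ

/-- **END (2.16)-shape FOR THE DIFFERENCE, x-UNIFORM** — rider (ρ3) in the currency (T1) consumes:
`WRS κ d (G₃(σ) − G₃(0)) (2(ρ + Xρ(ρ′ρ))/R·‖σ‖)` with `G₃ = termSum (recombTerm TG TL c)`, for every `‖c‖ ≤ X`
(an4's `wrs_termSum_sub_of_termwise` BY NAME through `TermData.wrs_termSum_sub`).
[cite: Balaban1988RG2Cluster, (2.16)–(2.17) p.16] -/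
theorem wrs_recomb_sub [Nonempty n] (hG : TermData κ d R TG mG ρG) (hL : TermData κ d R TL mL ρL)
    (hw : WeightHyp κ d) (hR : 0 < R) {c : ℂ} {X ρ ρ' : ℝ} (hc : ‖c‖ ≤ X) (hρG : ∑' w, ρG w ≤ ρ)
    (hρL : ∑' v, ρL v ≤ ρ') {σ : ℂ} (hσ : σ ∈ ball (0 : ℂ) R) :
    WRS κ d (termSum (recombTerm TG TL c) σ - termSum (recombTerm TG TL c) 0)
      (2 * (ρ + X * (ρ * (ρ' * ρ))) / R * ‖σ‖) :=
  (termData_recomb hG hL hw hR hc).wrs_termSum_sub hw hR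
    (tsum_recombConst_le hG hL hw hR ((norm_nonneg c).trans hc) hρG hρL) hσ

/-- **`G₃` IS THE SUMMED RECOMBINED FAMILY**: if, at a point of the disc, `G σ := termSum TG σ` is invertible,
`1 + c·QG σP` is invertible, and the second family sums to the lifted unit-lattice inverse
`termSum TL σ = P(1 + c·QG σP)⁻¹Q` (A3's output read at `K = QG σP`), then
`(G σ⁻¹ + P(c·1)Q)⁻¹ = termSum (recombTerm TG TL c) σ` — so `G₃(x) = (G₂⁻¹ + xQ̂*Q̂)⁻¹` inherits the x-uniform
(2.16) data of §2 (for `c = 0` both sides are `G σ`, trivially). [cite: Balaban1988RG2Cluster, p.13 after (2.7)] -/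
theorem woodbury_termSum [Nonempty n] [DecidableEq n] {Y : Type*} [Fintype Y] [DecidableEq Y]
    (hG : TermData κ d R TG mG ρG)
    (hL : TermData κ d R TL mL ρL) (hw : WeightHyp κ d) (hR : 0 < R) (P : Matrix n Y ℂ) (Q : Matrix Y n ℂ)
    {c : ℂ} (hc : c ≠ 0) {σ : ℂ} (hσ : σ ∈ ball (0 : ℂ) R) (hGu : IsUnit (termSum TG σ))
    (hK : IsUnit (1 + c • (Q * termSum TG σ * P)))
    (hTL : termSum TL σ = P * (1 + c • (Q * termSum TG σ * P))⁻¹ * Q) :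
    ((termSum TG σ)⁻¹ + P * (c • (1 : Matrix Y Y ℂ)) * Q)⁻¹ = termSum (recombTerm TG TL c) σ := by
  rw [termSum_recomb hG hL hw hR c hσ, woodbury (termSum TG σ) P Q hc hGu hK, hTL]
  simp only [Matrix.mul_assoc]

end Recomb

/-! ## §4 The locality interface is closed under the recombination

`DecouplingSupport110.BlockLocal cube H σ W` (an4 gen 34): for decoration parameters vanishing off the live family `σ`, the
decorated kernel `H(τ)` has no entry from the cube family `W` to its outside, and its entries inside `W` ignore the live
parameters outside `W` — the interface through which the (1.9) = (1.10) ENDs consume «localized in the interior of Y»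
([II] p. 10).  Products, sums, scalar multiples and the identity preserve it, hence so does `G − c·G·L·G`. -/

section Locality

open Literature.MathematicalPhysics.QuantumFieldTheory.Balaban1983to89.B14DomainGeom (Pt)
open Summit.QuantumFields.BalabanUV.Beta.DecouplingSupport110 (VanishOff BlockLocal)

variable {dd : ℕ} {Λ : Type*} [Fintype Λ] {cube : Λ → Pt dd} {σ W : Finset (Pt dd)}
  {H₁ H₂ : (Pt dd → ℂ) → Matrix Λ Λ ℂ}

/-- **Products of block-local decorated kernels are block-local** (same cube family): the middle site is either in `W`
(both factors idle) or outside (the left factor's entry vanishes). [folklore] -/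
theorem blockLocal_mul (h₁ : BlockLocal cube H₁ σ W) (h₂ : BlockLocal cube H₂ σ W) :
    BlockLocal cube (fun τ => H₁ τ * H₂ τ) σ W where
  off τ hτ x y hx hy := by
    rw [Matrix.mul_apply]
    refine Finset.sum_eq_zero fun z _ => ?_
    by_cases hz : cube z ∈ W
    · rw [h₂.off τ hτ z y hz hy, mul_zero]
    · rw [h₁.off τ hτ x z hx hz, zero_mul]
  idle τ hτ Δ' hΔ' hW c x y hx hy := by
    rw [Matrix.mul_apply, Matrix.mul_apply]
    refine Finset.sum_congr rfl fun z _ => ?_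
    by_cases hz : cube z ∈ W
    · rw [h₁.idle τ hτ Δ' hΔ' hW c x z hx hz, h₂.idle τ hτ Δ' hΔ' hW c z y hz hy]
    · rw [h₁.off _ (hτ.update hΔ' c) x z hx hz, h₁.off τ hτ x z hx hz, zero_mul, zero_mul]

omit [Fintype Λ] in
/-- Sums of block-local decorated kernels are block-local. [folklore] -/
theorem blockLocal_add (h₁ : BlockLocal cube H₁ σ W) (h₂ : BlockLocal cube H₂ σ W) :
    BlockLocal cube (fun τ => H₁ τ + H₂ τ) σ W where
  off τ hτ x y hx hy := by rw [Matrix.add_apply, h₁.off τ hτ x y hx hy, h₂.off τ hτ x y hx hy, add_zero]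
  idle τ hτ Δ' hΔ' hW c x y hx hy := by
    rw [Matrix.add_apply, Matrix.add_apply, h₁.idle τ hτ Δ' hΔ' hW c x y hx hy, h₂.idle τ hτ Δ' hΔ' hW c x y hx hy]

omit [Fintype Λ] in
/-- Scalar multiples of block-local decorated kernels are block-local. [folklore] -/
theorem blockLocal_smul (h₁ : BlockLocal cube H₁ σ W) (a : ℂ) : BlockLocal cube (fun τ => a • H₁ τ) σ W where
  off τ hτ x y hx hy := by rw [Matrix.smul_apply, h₁.off τ hτ x y hx hy, smul_zero]
  idle τ hτ Δ' hΔ' hW c x y hx hy := by rw [Matrix.smul_apply, Matrix.smul_apply, h₁.idle τ hτ Δ' hΔ' hW c x y hx hy]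

omit [Fintype Λ] in
/-- The identity (undecorated) is block-local for every cube family. [folklore] -/
theorem blockLocal_one [DecidableEq Λ] : BlockLocal cube (fun _ : Pt dd → ℂ => (1 : Matrix Λ Λ ℂ)) σ W where
  off _ _ _ _ hx hy := Matrix.one_apply_ne (fun h => hy (h ▸ hx))
  idle _ _ _ _ _ _ _ _ _ _ := rfl

/-- **The recombination preserves block-locality**: if the decorated `G(τ)` and `L(τ)` are block-local at `(σ, W)`, so is
`G(τ) − c·G(τ)L(τ)G(τ)` — the U∕s-locality clause of rider (ρ3) in an4's interface. [folklore] -/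
theorem blockLocal_recomb (hG : BlockLocal cube H₁ σ W) (hL : BlockLocal cube H₂ σ W) (c : ℂ) :
    BlockLocal cube (fun τ => H₁ τ - c • (H₁ τ * (H₂ τ * H₁ τ))) σ W := by
  have h := blockLocal_add hG (blockLocal_smul (blockLocal_mul hG (blockLocal_mul hL hG)) (-c))
  refine ⟨fun τ hτ x y hx hy => ?_, fun τ hτ Δ' hΔ' hW z x y hx hy => ?_⟩
  · simpa only [sub_eq_add_neg, neg_smul] using h.off τ hτ x y hx hy
  · simpa only [sub_eq_add_neg, neg_smul] using h.idle τ hτ Δ' hΔ' hW z x y hx hy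

end Locality

/-! ## §5 Non-vacuity -/

/-- The hypotheses of `wrs_recomb_sub` are jointly satisfiable (one bond, one-term families `σ ↦ σ`, `X = 2`,
`ρ = ρ′ = 1`). [folklore] -/
example : WRS (n := Unit) 0 (fun _ _ => 0)
    (termSum (recombTerm (fun (_ : Unit) (σ : ℂ) => fun (_ _ : Unit) => σ)
        (fun (_ : Unit) (σ : ℂ) => fun (_ _ : Unit) => σ) (2 : ℂ)) (1 / 2) -
      termSum (recombTerm (fun (_ : Unit) (σ : ℂ) => fun (_ _ : Unit) => σ)
        (fun (_ : Unit) (σ : ℂ) => fun (_ _ : Unit) => σ) (2 : ℂ)) 0)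
    (2 * (1 + 2 * (1 * (1 * 1))) / 1 * ‖(1 / 2 : ℂ)‖) := by
  have hw : WeightHyp (n := Unit) 0 (fun _ _ => 0) := ⟨le_rfl, fun _ => rfl, fun _ _ => le_rfl, fun _ _ _ => by simp⟩
  have h := AnalyticWalkSum216Algebra.termData_example
  refine wrs_recomb_sub h h hw one_pos (X := 2) (by simp) (by simp) (by simp) ?_
  rw [mem_ball_zero_iff]; norm_num

end

end Summit.QuantumFields.BalabanUV.Beta.AnalyticWalkSum216Recomb
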